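import Literature.Analysis.FluidPDE.ChaeWolfDSSDecayLtNine
import HarnessLib

/-!
# Chae–Wolf 2017, Theorem 1.1 (Type I bound for `λ`-DSS solutions): decomposition by the
# exponent ranges of the printed proof

Analysis/FluidPDE fact-decomposition file (librarian, mode `fact-decompose`, 2026-08-16) for the
named fact `Literature.Analysis.FluidPDE.chaeWolf2017_dss_typeI_decay` (`ChaeWolfRemovingDSS.lean`;
D. Chae, J. Wolf, *Removing discretely self-similar singularities for the 3D Navier–Stokes
equations*, Comm. PDE 42 (2017) = arXiv:1610.09464, Thm. 1.1: a `λ`-DSS classical solution on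
`ℝ³ × (−∞, 0)` with `u ∈ C((−∞,0); L^p)`, `3 ≤ p < ∞`, obeys `|u(x,t)| ≤ C/(|x| + √(−t))`).

The printed proof (§2, pp. 5–7) treats the regular point `z₀ = (x₀, 0)`, `x₀ ≠ 0`, by an
ε-regularity criterion applied on parabolic cylinders `Q(z₀, r)`, after Steps (2.4a)–(2.5)
(time asymptotics of `‖u(t)‖_p`, local energy and pressure classes up to `t = 0`, the weighted
Serrin bound). The tree PROVES the theorem in the range `3 ≤ p < 9`
(`chaeWolf2017_dss_typeI_decay_of_lt_nine`, `ChaeWolfDSSDecayLtNine.lean`, with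
`chaeWolf2017_dss_typeI_decay_three` for `p = 3`): there the `L^{3/2}` pressure class is available
(`3κ < 1` for the rate `κ = (p−3)/(2p)`) and the Caffarelli–Kohn–Nirenberg-type criterion of
Gustafson–Kang–Tsai at the top point closes the argument. For `p ≥ 9` the printed proof absorbs
the terms `II`, `III` of (2.4f) differently and invokes **Wolf's pressure-free ε-regularity
criterion** (J. Wolf, *On the local regularity of suitable weak solutions to the generalized
Navier–Stokes equations*, Ann. Univ. Ferrara 61 (2015) 149–171), which has no counterpart in the
tree. The remaining printed case is vended as the child

* `chaeWolf2017_dss_typeI_decay_ge_nine` — Thm. 1.1 for `9 ≤ p < ∞`,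

and `chaeWolf2017_dss_typeI_decay_holds_of` PROVES the parent from it and the tree's `p < 9`
theorem. The child is a proper part of the parent (the exponent range where a different
ε-regularity input is needed), not a restatement: it neither implies nor is trivially implied by
the proved range (no monotonicity in `p` is available for `λ`-DSS fields, whose slices are in no
`L^q`, `q ≠ p`, in general).

## References

* D. Chae, J. Wolf, arXiv:1610.09464, Thm. 1.1 and §2 (pp. 5–7), in particular the case
  distinction after (2.4f). [ChaeWolf2017RemovingDSS]
* J. Wolf, Ann. Univ. Ferrara 61 (2015) 149–171 (pressure-free local regularity criterion).
* S. Gustafson, K. Kang, T.-P. Tsai, Comm. Math. Phys. 273 (2007), Thm. 1.1. [GustafsonKangTsai2007]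
-/

noncomputable section

open MeasureTheory Set

namespace Literature.Analysis.FluidPDE

/-- **Chae–Wolf 2017, Theorem 1.1 in the range `p ≥ 9` (child of `chaeWolf2017_dss_typeI_decay`).**
For real `q ≥ 9`, `c > 1`, every classical solution `(u, p)` of the unforced Navier–Stokes
equations with viscosity `1` on the time set `(−∞, 0)` whose slices lie in `L^q(ℝ³)` and depend
continuously on `t` in `L^q`, and which is `c`-discretely self-similar, obeys a Type I bound
`‖u(t,x)‖ ≤ C/(‖x‖ + √(−t))` (`HasTypeIDecay C u`, (1.5)). In this range the printed proof (§2,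
after (2.4f)) uses Wolf's pressure-free ε-regularity criterion at the top points `(x₀, 0)`,
`x₀ ≠ 0`, in place of the `L^{3/2}`-pressure criterion available for `p < 9`. Same binders as the
parent with `9 ≤ q`. [cite: ChaeWolf2017RemovingDSS, Theorem 1.1 with (1.5), case p ≥ 9 (§2, after (2.4f))] -/
def chaeWolf2017_dss_typeI_decay_ge_nine : Prop :=
  ∀ q : ℝ, 9 ≤ q → ∀ c : ℝ, 1 < c →
    ∀ (u : ℝ → EuclideanSpace ℝ (Fin 3) → EuclideanSpace ℝ (Fin 3))
      (p : ℝ → EuclideanSpace ℝ (Fin 3) → ℝ), IsClassicalNSSolutionOn (Iio 0) 1 0 u p →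
      (∀ t < 0, MemLp (u t) (ENNReal.ofReal q) volume) →
      (∀ t₀ < 0, Filter.Tendsto (fun t => eLpNorm (u t - u t₀) (ENNReal.ofReal q) volume)
        (nhdsWithin t₀ (Iio 0)) (nhds 0)) →
      IsDiscretelySelfSimilar c u → ∃ C : ℝ, HasTypeIDecay C u

/-- **Assembly (PROVED): Theorem 1.1 in full from its two exponent ranges** — `3 ≤ q < 9` by the
tree's `chaeWolf2017_dss_typeI_decay_of_lt_nine`, `q ≥ 9` by the child.
[cite: ChaeWolf2017RemovingDSS, Theorem 1.1] -/
theorem chaeWolf2017_dss_typeI_decay_holds_of (h9 : chaeWolf2017_dss_typeI_decay_ge_nine) :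
    chaeWolf2017_dss_typeI_decay := by
  intro q hq c hc u p hsol hLq hcont hdss
  rcases lt_or_ge q 9 with hq9 | hq9
  · exact chaeWolf2017_dss_typeI_decay_of_lt_nine q hq hq9 c hc u p hsol hLq hcont hdss
  · exact h9 q hq9 c hc u p hsol hLq hcont hdss

end Literature.Analysis.FluidPDE

end
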